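import Literature.AlgebraicGeometry.Resolution.KnafKuhlmann2009Prop23
import HarnessLib

/-!
# A separating transcendence basis led by a uniformizer (`stub_uniformizer_separating`)

Stub of the birth line of the crux `ShadowsUniformize` (route `AbhyankarShadows`), discrete
branch (Knaf–Kuhlmann 2009, Thm. 1.5 / Prop. 3.11: relative local uniformization at a discrete
rational place).

Setting (ambient rendering of `ValuedFunctionFields.lean`): one valued field `(Ω, V)`, subfields
`k' ≤ K'` of `Ω` with `k'` perfect and `k' ⊆ V`, `K' | k'` finitely generated, `t ∈ K'` with
`v t < 1` and every non-zero value of `K'` an integral power of `v t` (`hdisc`).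

Claim: there are `t' ∈ K'` with `v t' = v t` and `x₁, …, xₙ ∈ K'` such that each `xᵢ` is
transcendental over `k'(t', x_{<i})` (rendered polynomially) and `K' | k'(t', x)` is finite
separable — i.e. `(t', x)` is a separating transcendence basis of `K' | k'` led by an element of
the value of `t`, delivered as a tower.

Proof (differential criterion, `KnafKuhlmann2009Prop23.lean`). Since `k'` is perfect,
`K' | k'` has a separating transcendence basis `b = (b_k)_{k ∈ t₀}`
(`separablyGeneratedOver_of_perfectField`); pass to an intermediate field `M ≅ K'` of `Ω | k'`
(`exists_bridge`), where the differentials `d b_k` span `Ω[M⁄k']` (`span_range_D_eq_top`). If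
`t = 0` take `t' := 0`, `x := b`. Otherwise `t` is transcendental over `k'` (an element
algebraic over `k' ⊆ V` is a unit of `V`), so `t₀ ≠ ∅`. If `d t ≠ 0`, write
`d t = ∑ f_k d b_k`, pick `k₀` with `f_{k₀} ≠ 0` and EXCHANGE: `t' := t`. If `d t = 0`, pick
any `k₀`, write `v b_{k₀} = (v t)^{m₀}` (`hdisc`) and put `t' := t + t^j b_{k₀}` with
`j = |m₀| + 2`: then `d t' = t^j d b_{k₀}` (as `d t = 0`) and
`v (t^j b_{k₀}) = (v t)^{j + m₀} ≤ (v t)^2 < v t`, so `v t' = v t`. In both cases the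
differentials of `c := b[k₀ ↦ t']` span `Ω[M⁄k']` (`span_eq_top_of_exchange`), so `c` is a
separating transcendence basis (`isTranscendenceBasis_of_span_range_D_eq_top`,
`isSeparable_adjoin_of_span_range_D_eq_top`); `x` enumerates the `b_k`, `k ≠ k₀`. The tower form
follows from algebraic independence (`AlgebraicIndependent.transcendental_adjoin`) and the finite
separable top from the generators of `K' | k'`.
-/

noncomputable section

-- single-problem summit: the doubled namespace component is forced
set_option linter.dupNamespace false

open Literature.AlgebraicGeometry.Resolution KaehlerDifferential

namespace Summit.ResolutionOfSingularities.ResolutionOfSingularities.Theorems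

/-- **Exchange of one spanning vector.** If the `v k` span, `w` agrees with `v` off `k₀`, and
`w k₀ ≡ μ • v k₀` modulo the span of the other `v k` with `μ ≠ 0`, then the `w k` span.
[folklore] -/
theorem span_eq_top_of_exchange {R N : Type*} [DivisionRing R] [AddCommGroup N] [Module R N]
    {ι : Type*} (v w : ι → N) (hv : Submodule.span R (Set.range v) = ⊤) (k₀ : ι)
    (hw : ∀ k, k ≠ k₀ → w k = v k) (μ : R) (hμ : μ ≠ 0)
    (hs : w k₀ - μ • v k₀ ∈ Submodule.span R (v '' {k | k ≠ k₀})) :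
    Submodule.span R (Set.range w) = ⊤ := by
  set P := Submodule.span R (Set.range w) with hP
  have hwP : ∀ k, w k ∈ P := fun k => Submodule.subset_span ⟨k, rfl⟩
  have hvP : ∀ k, k ≠ k₀ → v k ∈ P := fun k hk => hw k hk ▸ hwP k
  have h1 : Submodule.span R (v '' {k | k ≠ k₀}) ≤ P := by
    refine Submodule.span_le.mpr ?_
    rintro _ ⟨k, hk, rfl⟩
    exact hvP k hk
  have h2 : μ • v k₀ ∈ P := by
    have := P.sub_mem (hwP k₀) (h1 hs)
    rwa [sub_sub_cancel] at this
  have h3 : v k₀ ∈ P := by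
    have := P.smul_mem μ⁻¹ h2
    rwa [smul_smul, inv_mul_cancel₀ hμ, one_smul] at this
  rw [eq_top_iff, ← hv, Submodule.span_le]
  rintro _ ⟨k, rfl⟩
  by_cases hk : k = k₀
  · rw [hk]; exact h3
  · exact hvP k hk

variable {Ω : Type*} [Field Ω]

/-- **Tower form of algebraic independence.** If `G` is algebraically independent over the
subfield `K` and `i ∉ S`, a polynomial over `Ω` with coefficients in `K(G(S))` vanishing at
`G i` is zero. [folklore] -/
theorem eq_zero_of_algebraicIndependent_of_notMem {K : Subfield Ω} {ι : Type*} {G : ι → Ω}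
    (hG : AlgebraicIndependent K G) {S : Set ι} {i : ι} (hi : i ∉ S) (P : Polynomial Ω)
    (hP : ∀ m, P.coeff m ∈ Subfield.closure ((K : Set Ω) ∪ G '' S)) (h : P.eval (G i) = 0) :
    P = 0 := by
  have htr : Transcendental (Subfield.closure ((K : Set Ω) ∪ G '' S)) (G i) := by
    intro halg
    have h1 : IsAlgebraic (IntermediateField.adjoin K (G '' S)) (G i) :=
      (isAlgebraic_closure_iff K (G '' S) (G i)).mp halg
    exact (IntermediateField.transcendental_adjoin_iff.mpr (hG.transcendental_adjoin hi)) h1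
  obtain ⟨P', hP'⟩ : ∃ P' : Polynomial (Subfield.closure ((K : Set Ω) ∪ G '' S)),
      P'.map (algebraMap _ Ω) = P :=
    (Polynomial.mem_lifts P).mp ((Polynomial.lifts_iff_coeff_lifts P).mpr
      fun k => ⟨⟨P.coeff k, hP k⟩, rfl⟩)
  by_contra hP0
  refine htr ⟨P', fun h0 => hP0 ?_, ?_⟩
  · rw [← hP', h0, Polynomial.map_zero]
  · rw [Polynomial.aeval_def, ← Polynomial.eval_map, hP', h]

/-- **Finite separable top of a separating family.** If `F | K` is finitely generated, `A ⊆ F`,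
and every element of `F` is separable over `K(A)`, then `F | K(A)` is finite separable (in the
sense of `FiniteSeparableOver`, with the generators of `F | K` as witnesses). [folklore] -/
theorem finiteSeparableOver_closure_of_isSeparable {K F : Subfield Ω} (hKF : K ≤ F)
    (hfg : FGOver K F) {A : Set Ω} (hA : A ⊆ F)
    (hsep : ∀ z ∈ F, IsSeparable (IntermediateField.adjoin K A) z) :
    FiniteSeparableOver (Subfield.closure ((K : Set Ω) ∪ A)) F := by
  obtain ⟨s, hs⟩ := hfg
  have hsF : (s : Set Ω) ⊆ F := fun z hz => hs ▸ Subfield.subset_closure (Or.inr hz)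
  refine ⟨s, fun z hz => (isSeparable_closure_iff K A z).mpr (hsep z (hsF hz)),
    le_antisymm ?_ ?_⟩
  · exact Subfield.closure_le.mpr
      (Set.union_subset (Subfield.closure_le.mpr (Set.union_subset hKF hA)) hsF)
  · calc F = Subfield.closure ((K : Set Ω) ∪ s) := hs.symm
      _ ≤ _ := Subfield.closure_mono (Set.union_subset_union_left _ fun x hx =>
          Subfield.subset_closure (Or.inl hx))

/-- **A separating transcendence basis led by a uniformizer, as a tower.** For `k'` perfect,
`K' | k'` finitely generated, `t ∈ K'` with `v t < 1` and every non-zero value of `K'` a power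
of `v t`: there are `t' ∈ K'` with `v t' = v t` and `x₁, …, xₙ ∈ K'` with each `xᵢ`
transcendental over `k'(t', x_{<i})` and `K' | k'(t', x)` finite separable. (Differential
criterion: `K'|k'` has a separating transcendence basis `b`; if `dt ≠ 0` exchange `t` into it,
else `t' := t + t^j b_{k₀}` with `d t' = t^j d b_{k₀} ≠ 0`, `v(t^j b_{k₀}) < v t`.)
[cite: KnafKuhlmann2009, Prop. 2.3] -/
theorem stub_uniformizer_separating {Ω : Type} [Field Ω] (V : ValuationSubring Ω)
    (k' K' : Subfield Ω) [PerfectField k'] (t : Ω) (hkK : k' ≤ K') (hfg : FGOver k' K')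
    (hkV : (k' : Set Ω) ⊆ V) (ht : t ∈ K') (ht1 : V.valuation t < 1)
    (hdisc : ∀ y ∈ K', y ≠ 0 → ∃ m : ℤ, V.valuation y = V.valuation t ^ m) :
    ∃ (t' : Ω) (n : ℕ) (x : Fin n → Ω), t' ∈ K' ∧ V.valuation t' = V.valuation t ∧
      (∀ i, x i ∈ K') ∧
      (∀ i : Fin n, ∀ P : Polynomial Ω,
        (∀ m, P.coeff m ∈ Subfield.closure ((k' : Set Ω) ∪ insert t' (x '' {j | j < i}))) →
        P.eval (x i) = 0 → P = 0) ∧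
      FiniteSeparableOver (Subfield.closure ((k' : Set Ω) ∪ insert t' (Set.range x))) K' := by
  classical
  -- (1) a separating transcendence basis `t₀` of `K' | k'` and the bridge `M ≅ K'`
  obtain ⟨t₀, ht₀F, hind₀, hsep₀⟩ := separablyGeneratedOver_of_perfectField hfg
  obtain ⟨M, hMF, hess, b, hbcoe, -, hsepM, htr, hbound⟩ :=
    exists_bridge hfg ht₀F hind₀ hsep₀
  haveI := hess
  haveI hsepI : Algebra.IsSeparable (IntermediateField.adjoin k' (Set.range b)) M := ⟨hsepM⟩
  by_cases ht0 : t = 0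
  · -- degenerate case `t = 0`: `t' := 0` and `x` an enumeration of `t₀`
    set n := t₀.card
    let e : t₀ ≃ Fin n := t₀.equivFin
    let x : Fin n → Ω := fun i => (e.symm i : Ω)
    have hxF : ∀ i, x i ∈ K' := fun i => ht₀F (e.symm i).2
    have hrange : Set.range x = (t₀ : Set Ω) := by
      ext w; constructor
      · rintro ⟨i, rfl⟩; exact (e.symm i).2
      · intro hw; exact ⟨e ⟨w, hw⟩, by simp [x]⟩
    have hxind : AlgebraicIndependent k' x := hind₀.comp _ e.symm.injective
    refine ⟨0, n, x, K'.zero_mem, by rw [ht0], hxF, ?_, ?_⟩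
    · intro i P hP hev
      have hset : ((k' : Set Ω) ∪ insert (0 : Ω) (x '' {j | j < i})) =
          (k' : Set Ω) ∪ x '' {j | j < i} := by
        rw [Set.union_insert, Set.insert_eq_of_mem (Set.mem_union_left (x '' {j | j < i})
          (show (0 : Ω) ∈ (k' : Set Ω) from k'.zero_mem))]
      rw [hset] at hP
      exact eq_zero_of_algebraicIndependent_of_notMem hxind (S := {j | j < i})
        (fun h => lt_irrefl i h) P hP hev
    · refine finiteSeparableOver_closure_of_isSeparable hkK hfg ?_ ?_
      · exact Set.insert_subset K'.zero_mem (Set.range_subset_iff.mpr hxF)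
      · intro z hz
        refine isSeparable_adjoin_of_subset ?_ (hsep₀ z hz)
        rw [← hrange]
        exact Set.subset_insert _ _
  · -- `t` is transcendental over `k'` (else `t, t⁻¹ ∈ V` and `v t = 1`)
    have htr_t : Transcendental k' t := by
      intro halg
      have htV' : t⁻¹ ∈ V := mem_of_isIntegral_of_subset hkV halg.inv.isIntegral
      have h1 : V.valuation t⁻¹ ≤ 1 := (V.valuation_le_one_iff _).mpr htV'
      rw [map_inv₀, inv_le_one₀ (zero_lt_iff.mpr ((map_ne_zero V.valuation).mpr ht0))] at h1
      exact absurd ht1 (not_lt.mpr h1)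
    let tM : M := ⟨t, (hMF t).mpr ht⟩
    have htM0 : tM ≠ 0 := fun h => ht0 (congrArg Subtype.val h)
    -- `t₀` is non-empty
    have hcard : 1 ≤ t₀.card :=
      hbound 1 (fun _ => t) (fun _ => ht) (algebraicIndependent_unique_type_iff.mpr htr_t)
    -- (2) `k₀` and `s ∈ M` with `v s = v t`, `d s ≡ μ • d b_{k₀}` modulo the other `d b_k`
    obtain ⟨k₀, s, μ, hvs, hμ, hs⟩ : ∃ (k₀ : t₀) (s : M) (μ : M),
        V.valuation (s : Ω) = V.valuation t ∧ μ ≠ 0 ∧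
        D k' M s - μ • D k' M (b k₀) ∈
          Submodule.span M ((fun k => D k' M (b k)) '' {k | k ≠ k₀}) := by
      by_cases hD : D k' M tM = 0
      · -- `d t = 0`: perturb `t` by `t ^ j * b k₀`
        obtain ⟨k, hk⟩ := Finset.card_pos.mp hcard
        let k₀ : t₀ := ⟨k, hk⟩
        have hb0 : (b k₀ : Ω) ≠ 0 := by rw [hbcoe]; exact hind₀.ne_zero k₀
        have hbK : (b k₀ : Ω) ∈ K' := (hMF _).mp (b k₀).2
        obtain ⟨m₀, hm₀⟩ := hdisc _ hbK hb0
        let j : ℕ := m₀.natAbs + 2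
        refine ⟨k₀, tM + tM ^ j * b k₀, tM ^ j, ?_, pow_ne_zero _ htM0, ?_⟩
        · -- the value of `t' = t + t ^ j * b k₀` is `v t`
          have hcoe : ((tM + tM ^ j * b k₀ : M) : Ω) = t + t ^ j * (b k₀ : Ω) := by
            simp [tM]
          rw [hcoe]
          refine Valuation.map_add_eq_of_lt_left _ ?_
          set γ := V.valuation t
          have hγ0 : γ ≠ 0 := (map_ne_zero V.valuation).mpr ht0
          rw [map_mul, map_pow, hm₀]
          obtain ⟨N, hN⟩ : ∃ N : ℕ, (m₀.natAbs : ℤ) + m₀ = N :=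
            Int.eq_ofNat_of_zero_le (by omega)
          calc γ ^ j * γ ^ m₀ = γ ^ 2 * (γ ^ (m₀.natAbs : ℤ) * γ ^ m₀) := by
                simp only [j, pow_add, zpow_natCast]
                rw [mul_comm _ (γ ^ 2), mul_assoc]
            _ = γ ^ 2 * γ ^ (N : ℤ) := by rw [← zpow_add₀ hγ0, hN]
            _ ≤ γ ^ 2 * 1 := by
                refine mul_le_mul_right ?_ _
                rw [zpow_natCast]
                exact pow_le_one' ht1.le _
            _ = γ * γ := by rw [mul_one, pow_two]
            _ < 1 * γ := mul_lt_mul_of_pos_right ht1 (zero_lt_iff.mpr hγ0)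
            _ = γ := one_mul γ
        · -- `d t' = t ^ j • d b_{k₀}`
          have hD' : D k' M (tM + tM ^ j * b k₀) = tM ^ j • D k' M (b k₀) := by
            simp only [map_add, Derivation.leibniz, Derivation.leibniz_pow, hD, smul_zero,
              add_zero, zero_add]
          rw [hD', sub_self]
          exact Submodule.zero_mem _
      · -- `d t ≠ 0`: exchange
        have hmem : D k' M tM ∈ Submodule.span M (Set.range fun k => D k' M (b k)) := by
          rw [span_range_D_eq_top b]; trivial
        obtain ⟨f, hf⟩ := (Submodule.mem_span_range_iff_exists_fun M).mp hmem
        have hk₀ : ∃ k₀, f k₀ ≠ 0 := by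
          by_contra hno
          push Not at hno
          apply hD
          rw [← hf]
          exact Finset.sum_eq_zero fun k _ => by rw [hno k, zero_smul]
        obtain ⟨k₀, hk₀⟩ := hk₀
        refine ⟨k₀, tM, f k₀, rfl, hk₀, ?_⟩
        rw [← hf, ← Finset.add_sum_erase _ _ (Finset.mem_univ k₀), add_sub_cancel_left]
        refine Submodule.sum_mem _ fun k hk => Submodule.smul_mem _ _
          (Submodule.subset_span ⟨k, ?_, rfl⟩)
        exact (Finset.mem_erase.mp hk).1
    -- (3) the new family `c := b[k₀ ↦ s]` is a separating transcendence basis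
    let c : t₀ → M := Function.update b k₀ s
    have hck₀ : c k₀ = s := Function.update_self ..
    have hcne : ∀ k, k ≠ k₀ → c k = b k := fun k hk => Function.update_of_ne hk ..
    have hspan : Submodule.span M (Set.range fun k => D k' M (c k)) = ⊤ := by
      refine span_eq_top_of_exchange (fun k => D k' M (b k)) (fun k => D k' M (c k))
        (span_range_D_eq_top b) k₀ (fun k hk => ?_) μ hμ ?_
      · show D k' M (c k) = D k' M (b k)
        rw [hcne k hk]
      · show D k' M (c k₀) - μ • D k' M (b k₀) ∈ _
        rw [hck₀]
        exact hs
    have hcT : IsTranscendenceBasis k' c :=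
      isTranscendenceBasis_of_span_range_D_eq_top c hspan (by
        rw [htr, Cardinal.mk_fintype, Fintype.card_coe])
    have hsepc : Algebra.IsSeparable (IntermediateField.adjoin k' (Set.range c)) M :=
      isSeparable_adjoin_of_span_range_D_eq_top c hspan
    have hcΩ : AlgebraicIndependent k' (fun k => (c k : Ω)) :=
      hcT.1.map' (f := M.val) fun a b h => Subtype.ext h
    -- (4) enumerate the `b k`, `k ≠ k₀`
    set n := Fintype.card {k : t₀ // k ≠ k₀}
    let e : {k : t₀ // k ≠ k₀} ≃ Fin n := Fintype.equivFin _
    let x : Fin n → Ω := fun i => ((e.symm i).1 : Ω)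
    let t' : Ω := (s : Ω)
    have hxF : ∀ i, x i ∈ K' := fun i => ht₀F (e.symm i).1.2
    have ht'F : t' ∈ K' := (hMF _).mp s.2
    have hxc : ∀ i, x i = (c (e.symm i).1 : Ω) := fun i => by
      show ((e.symm i).1 : Ω) = (c (e.symm i).1 : Ω)
      rw [hcne _ (e.symm i).2, hbcoe]
    let G : Option (Fin n) → Ω := fun o => o.elim t' x
    let σ : Option (Fin n) → t₀ := fun o => o.elim k₀ fun i => (e.symm i).1
    have hσ : Function.Injective σ := by
      rintro (_ | i) (_ | i') h
      · rfl
      · exact ((e.symm i').2 (h.symm : (e.symm i').1 = k₀)).elim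
      · exact ((e.symm i).2 (h : (e.symm i).1 = k₀)).elim
      · have h' : (e.symm i).1 = (e.symm i').1 := h
        rw [e.symm.injective (Subtype.ext h')]
    have hGσ : G = (fun k => (c k : Ω)) ∘ σ := by
      funext o
      rcases o with _ | i
      · show (s : Ω) = ((c k₀ : M) : Ω)
        rw [hck₀]
      · exact hxc i
    have hGind : AlgebraicIndependent k' G := by
      rw [hGσ]
      exact hcΩ.comp σ hσ
    have hrange : Set.range (fun k => (c k : Ω)) ⊆ insert t' (Set.range x) := by
      rintro _ ⟨k, rfl⟩
      by_cases hk : k = k₀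
      · refine Or.inl ?_
        show ((c k : M) : Ω) = (s : Ω)
        rw [hk, hck₀]
      · refine Or.inr ⟨e ⟨k, hk⟩, ?_⟩
        show ((e.symm (e ⟨k, hk⟩)).1 : Ω) = ((c k : M) : Ω)
        rw [e.symm_apply_apply, hcne k hk, hbcoe]
    have hsepΩ : ∀ z ∈ K',
        IsSeparable (IntermediateField.adjoin k' (insert t' (Set.range x))) z := by
      intro z hz
      have h1 : IsSeparable (IntermediateField.adjoin k' (Set.range c))
          (⟨z, (hMF _).mpr hz⟩ : M) :=
        Algebra.IsSeparable.isSeparable _ _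
      have h2 := isSeparable_adjoin_of_intermediateField M c h1
      exact isSeparable_adjoin_of_subset hrange h2
    -- (5) assemble
    refine ⟨t', n, x, ht'F, hvs, hxF, ?_, ?_⟩
    · intro i P hP hev
      have hS : (some i : Option (Fin n)) ∉ insert none (some '' {j : Fin n | j < i}) := by
        rintro (h | ⟨j, hj, hji⟩)
        · exact Option.some_ne_none _ h
        · cases Option.some_injective _ hji
          simp only [Set.mem_setOf_eq] at hj
          exact lt_irrefl _ hj
      have himg : G '' insert none (some '' {j : Fin n | j < i}) =
          insert t' (x '' {j | j < i}) := by
        rw [Set.image_insert_eq, Set.image_image]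
        rfl
      refine eq_zero_of_algebraicIndependent_of_notMem hGind hS P ?_ hev
      rw [himg]
      exact hP
    · exact finiteSeparableOver_closure_of_isSeparable hkK hfg
        (Set.insert_subset ht'F (Set.range_subset_iff.mpr hxF)) hsepΩ

end Summit.ResolutionOfSingularities.ResolutionOfSingularities.Theorems

end
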